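import Summits.NavierStokesRegularity.FluidComputer.GateBudgetLeakCeiling
import Summits.NavierStokesRegularity.FluidComputer.GateBudgetPulseLeak
import HarnessLib

/-!
# GateBudget part 75 — the leak ceiling of one pulse, II: the pulse ceiling (§226)

Cell `pub-fluidc`, blueprint seat bp1 (gen 36, third item, file 3 of 4); namespace
`Summit.NavierStokesRegularity.FluidComputer.GateBudget`, headline family
`RotorKnob.rotorCircuit K K¹⁰ ε ρ` from `delayInit` (`K ≥ 16`, window
`200ε/K²⁰ ≤ ρ² ≤ 2ε/K¹⁰`, lattice `ε = kK¹⁰ρ²`). HONEST FRAMING: a low prior, high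
value-of-information experiment on Tao's machine paradigm; NOT a claim that NS blows up.

* §226 `knob_pulse_ceiling`: for a pulse igniting at `b(r) = θε` (`5/4 ≤ θ ≤ 3/2`),
  `c(r) = ρ²/K⁹`, inside the kept ring, of duration `≤ 242/K⁹` and `≤ 241 log K/K¹⁰`, ending
  with `b(T') ≤ -(31/32)θε` and exit phase `|Φ(T') - kπ| ≤ δ`:
  `ã(T') - ã(r) ≤ (7/2 + k²/4 + 2d(r)²·log k + (520d(r)² + 1500δ²)·log K)/K⁹`.
  Assembly of part 73 §223 (phases: climb `b ≥ (31/32)θε` for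
  `≤ 32 log(c(t₁)/c(r))/(31θK¹⁰) ≤ 32(log k + 19 log K)/(31θK¹⁰)`, swing `≤ 4.16/(θK¹⁰)`
  spent at `ã' ≤ K`, fall `b ≤ -(15/16)θε`; `c(t₁)², c(t₂)² ≤ θ²ε²/16`) with part 74 §224
  (climb law) and §225 (fall law): `k²`-terms `(2048/29791 + 768/3375)/θ ≤ 0.239`, pair terms
  `64/(31θ)·d(r)²(log k + 19 log K) + 482d(r)²log K`, pin term `1446δ²log K`, swing `3.33`,
  drift and seed terms `≤ 0.005`.
* Part 76 §227 `knob_rung_two_sided` then puts §226 and part 71 §217's floor on the SAME fine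
  pulse of a normal-form ignition (pin `δ₀ ≤ 4k/K¹⁰` of part 52, `1500δ₀²log K ≤ k²/12`):
  `ã(r) + 1/K⁹ ≤ ã(T') ≤ ã(r) + (7/2 + k²/3 + (2 log k + 520 log K)·d(r)²)/K⁹`.

WHAT THIS SAYS (and does not). At `k = 1` the per-rung leak becomes two-sided (part 76),
`1/K⁹ ≤ Δã ≤ (4 + 520·d(r)²·log K)/K⁹`: floor and ceiling MATCH up to constants exactly when
`d(r)²log K ≲ 1`. The `d(r)²log K` term is REAL: while the trigger climbs from `ρ²/K⁹` (time
`≈ 19 log K/(θK¹⁰)`) the output runs at `ã' ≈ Kd(r)²`. So the clean dud horizon is two-sided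
`Θ(K⁹)` only together with a d-LEDGER locating the pair in `ã` (cold-phase damping
`d' = ρ⁻²ca - Kdã`), NOT attempted here; with the ladder's `d(r)² ≤ 1/50` alone the ceiling
reads `(4 + 10.4 log K)/K⁹` per rung against the `241 log K/K⁹` that part 65 §203 gives and
the fine ladder (part 67) spends — a constant-factor gain plus the split. HONEST LIMITS: (i)
`k²/4` where the truth is `O(log k)` (§224); (ii) swing at `ã' ≤ K`, fall at the fine
duration; (iii) headline family only, `ε² ≤ 1/(6K²⁰)` for the pin; (iv) nothing about NS.
[cite: Tao2016AveragedNS, §5.5 Theorem 5.3, (5.5), (b-eq), (c-eq), (d-eq), (energy-con)]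
-/

noncomputable section

namespace Summit.NavierStokesRegularity.FluidComputer.GateBudget

open Real Set Filter Topology
open Literature.Analysis.FluidPDE.Tao2016AveragedNS

variable {K M ε ρ : ℝ} {X : ℝ → Fin 5 → ℝ} {C : ℝ → ℝ}

/-! ## §226 The pulse ceiling -/

/-- The output is `K`-Lipschitz forward in time: `ã(t) - ã(s) ≤ K(t - s)` for `s ≤ t`
(`ã' = Kd² ≤ K`). [derived: RotorKnob (d-eq), (energy-con)] -/
theorem output_step_le (hX : ∀ t, HasDerivAt X (RotorKnob.rotorCircuit K M ε ρ (X t)) t)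
    (h0 : X 0 = delayInit) (hK : 0 ≤ K) {s t : ℝ} (hst : s ≤ t) :
    X t 4 - X s 4 ≤ K * (t - s) := by
  have hanti := Thm53.antitoneOn_sub_of_deriv_le (f := fun u => X u 4)
    (f' := fun u => K * X u 3 ^ 2) (Φ := fun u => K * u) (φ := fun _ => K) (convex_Icc s t)
    (fun u _ => RotorKnob.hasDerivAt_e hX u)
    (fun u _ => by simpa using (hasDerivAt_id' u).const_mul K)
    (fun u _ => by nlinarith only [RotorKnob.traj_sq_le_one hX h0 u 3, hK])
  have h := hanti (left_mem_Icc.2 hst) (right_mem_Icc.2 hst) hst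
  dsimp only at h
  linarith only [h]

set_option maxHeartbeats 400000 in
/-- §226 THE PULSE CEILING (headline member, `K ≥ 16`, `200ε/K²⁰ ≤ ρ² ≤ 2ε/K¹⁰`, lattice
`ε = kK¹⁰ρ²`). For a pulse on `[r, T']` (`r ≥ 0`) igniting at `b(r) = θε`, `5/4 ≤ θ ≤ 3/2`,
`c(r) = ρ²/K⁹`, staying in the kept ring with `c > 0`, of duration `T' - r ≤ 242/K⁹` and
`≤ 241 log K/K¹⁰`, ending with `b(T') ≤ -(31/32)θε` and exit phase `|Φ(T') - kπ| ≤ δ`: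
`ã(T') - ã(r) ≤ (7/2 + k²/4 + 2d(r)²log k + (520d(r)² + 1500δ²)log K)/K⁹`.
[derived: part 73 §223, part 74 §224/§225, this file] -/
theorem knob_pulse_ceiling
    (hX : ∀ t, HasDerivAt X (RotorKnob.rotorCircuit K (K ^ 10) ε ρ (X t)) t)
    (h0 : X 0 = delayInit) (hC : ∀ t, HasDerivAt C (X t 2) t) (hK : 16 ≤ K) (hε : 0 < ε)
    (hρ : 0 < ρ) (hlo : 200 * ε / K ^ 20 ≤ ρ ^ 2) (hhi : K ^ 10 * ρ ^ 2 ≤ 2 * ε) (k : ℕ)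
    (hk : ε = k * K ^ 10 * ρ ^ 2) {r T' θ δ : ℝ} (hr : 0 ≤ r) (hrT : r ≤ T')
    (hτ : T' - r ≤ 242 / K ^ 9) (hτ' : T' - r ≤ 241 * log K / K ^ 10) (hθ1 : 5 / 4 ≤ θ)
    (hθ2 : θ ≤ 3 / 2) (hbr : X r 1 = θ * ε) (hcr : X r 2 = ρ ^ 2 / K ^ 9)
    (hkept : ∀ t ∈ Icc r T', |X t 1 ^ 2 + X t 2 ^ 2 - (X r 1 ^ 2 + X r 2 ^ 2)| ≤ ε ^ 2 / 10 ^ 6)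
    (hpos : ∀ t ∈ Icc r T', 0 < X t 2) (hbT : X T' 1 ≤ -(31 / 32 * θ * ε))
    (hpin : |(C T' - C r) / ρ ^ 2 - k * π| ≤ δ) :
    X T' 4 - X r 4 ≤ (7 / 2 + k ^ 2 / 4 + 2 * X r 3 ^ 2 * log k
      + (520 * X r 3 ^ 2 + 1500 * δ ^ 2) * log K) / K ^ 9 := by
  have hK0 : (0 : ℝ) < K := by linarith
  have hK1 : (1 : ℝ) ≤ K := by linarith
  obtain ⟨hk1, h200, -, -, -, -⟩ := leak_numerics hK hε hρ hlo k hk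
  have hk0 : (0 : ℝ) < k := by linarith
  have hlogK : 0 ≤ log K := log_nonneg hK1
  have hlogk : 0 ≤ log (k : ℝ) := log_nonneg hk1
  have hθ0 : 0 < θ := by linarith
  have hθi : θ⁻¹ ≤ 4 / 5 := by rw [inv_le_comm₀ hθ0 (by norm_num)]; linarith only [hθ1]
  have hτ0 : 0 ≤ T' - r := by linarith
  have hε1 : ε ≤ 4 / 5 := by
    have hb1 := (abs_le.1 (RotorKnob.traj_abs_le_one hX h0 r 1)).2
    rw [hbr] at hb1
    nlinarith only [hb1, hθ1, hε]
  have hKK : K ≤ K ^ 10 := le_self_pow₀ hK1 (by norm_num)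
  have hρε : ρ ^ 2 ≤ ε := by nlinarith only [hhi, hKK, hK, sq_nonneg ρ, hε]
  have hρk : ρ ^ 2 = ε / (k * K ^ 10) := by rw [hk]; field_simp
  have hexp1 : exp (-K ^ 10) ≤ 1 := exp_le_one_iff.2 (by simp [pow_nonneg hK0.le])
  -- the phases (part 73 §223)
  obtain ⟨t₁, t₂, hrt₁, ht₁₂, ht₂T, hb1, hc1, hclimb, hswing, hc2, hbfall⟩ :=
    pulse_clock_phases hX h0 hK hε hρ hhi hrT hτ hθ1 hbr hcr hkept hpos hbT
  have hrt₂ : r ≤ t₂ := hrt₁.le.trans ht₁₂.le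
  have ht₁T : t₁ ≤ T' := ht₁₂.le.trans ht₂T
  -- (1) the climb law (part 74 §224), (2) the swing at `ã' ≤ K`, (3) the fall law (§225)
  have hΔ1 := leak_climb hX h0 hC hK0.le hε k hk hr hrt₁.le ht₁T
    (by positivity : (0 : ℝ) < 31 / 32 * θ * ε) hb1
  have hΔ2 := output_step_le hX h0 hK0.le ht₁₂.le
  have hc2ε : ∀ u ∈ Icc t₂ T', X u 2 ≤ 2 * ε := by
    intro u hu
    have huI : u ∈ Icc r T' := ⟨hrt₂.trans hu.1, hu.2⟩
    have hring := (abs_le.1 (hkept u huI)).2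
    rw [hbr, hcr] at hring
    have h1 : (ρ ^ 2 / K ^ 9) ^ 2 ≤ ε ^ 2 :=
      pow_le_pow_left₀ (by positivity)
        ((div_le_self (sq_nonneg ρ) (one_le_pow₀ hK1)).trans hρε) 2
    have h2 : (θ * ε) ^ 2 ≤ (3 / 2 * ε) ^ 2 :=
      pow_le_pow_left₀ (by positivity) (by nlinarith only [hθ2, hε]) 2
    have h3 : X u 2 ^ 2 ≤ (2 * ε) ^ 2 := by
      nlinarith only [hring, h1, h2, sq_nonneg (X u 1), hε]
    exact (abs_le_of_sq_le_sq' h3 (by positivity)).2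
  have hΔ3 := leak_fall hX h0 hC hK0.le hε k hk hr hrt₂ ht₂T
    (by positivity : (0 : ℝ) < 15 / 16 * θ * ε) hbfall hc2ε hpin
  -- names
  obtain ⟨L, hL⟩ : ∃ L : ℝ, L = ε + ρ ^ 2 * exp (-K ^ 10) + K * X T' 4 := ⟨_, rfl⟩
  obtain ⟨κ₁, hκ₁⟩ : ∃ κ₁ : ℝ, κ₁ = K * k ^ 2 * ε / (K ^ 10 * (31 / 32 * θ * ε) ^ 3) :=
    ⟨_, rfl⟩
  obtain ⟨κ₂, hκ₂⟩ : ∃ κ₂ : ℝ, κ₂ = K * k ^ 2 * ε / (K ^ 10 * (15 / 16 * θ * ε) ^ 3) :=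
    ⟨_, rfl⟩
  obtain ⟨σ, hσ⟩ : ∃ σ : ℝ, σ = ρ ^ 2 * exp (-K ^ 10) := ⟨_, rfl⟩
  obtain ⟨ξ, hξ⟩ : ∃ ξ : ℝ, ξ = k * σ * (T' - r) / (15 / 16 * θ * ε) := ⟨_, rfl⟩
  rw [← hL, ← hκ₁] at hΔ1
  rw [← hL, ← hκ₂, ← hσ, ← hξ] at hΔ3
  have hσ0 : 0 ≤ σ := by rw [hσ]; positivity
  have hσρ : σ ≤ ρ ^ 2 := by
    rw [hσ]; exact (mul_le_mul_of_nonneg_left hexp1 (sq_nonneg ρ)).trans (mul_one _).le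
  have hκ₁0 : 0 ≤ κ₁ := by rw [hκ₁]; positivity
  have hκ₂0 : 0 ≤ κ₂ := by rw [hκ₂]; positivity
  have hd0 := sq_nonneg (X r 3)
  -- (B1) climb k²-term, (B5) fall k²-term
  have hB1 : κ₁ * (X t₁ 2 ^ 2 - X r 2 ^ 2) ≤ 0.056 * k ^ 2 / K ^ 9 := by
    have e1 : κ₁ * (X t₁ 2 ^ 2 - X r 2 ^ 2) ≤ κ₁ * (θ ^ 2 * ε ^ 2 / 16) :=
      mul_le_mul_of_nonneg_left (by nlinarith only [hc1, sq_nonneg (X r 2)]) hκ₁0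
    have e2 : κ₁ * (θ ^ 2 * ε ^ 2 / 16) = 2048 / 29791 * θ⁻¹ * (k ^ 2 / K ^ 9) := by
      rw [hκ₁]; field_simp; ring
    have e3 : 2048 / 29791 * θ⁻¹ * (k ^ 2 / K ^ 9) ≤ 0.056 * (k ^ 2 / K ^ 9) :=
      mul_le_mul_of_nonneg_right (by nlinarith only [hθi]) (by positivity)
    have e4 : 0.056 * ((k : ℝ) ^ 2 / K ^ 9) = 0.056 * k ^ 2 / K ^ 9 := by ring
    linarith only [e1, e2.le, e3, e4.le]
  have hB5 : 3 * κ₂ * X t₂ 2 ^ 2 ≤ 0.183 * k ^ 2 / K ^ 9 := by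
    have e1 : 3 * κ₂ * X t₂ 2 ^ 2 ≤ 3 * κ₂ * (θ ^ 2 * ε ^ 2 / 16) :=
      mul_le_mul_of_nonneg_left hc2 (by positivity)
    have e2 : 3 * κ₂ * (θ ^ 2 * ε ^ 2 / 16) = 768 / 3375 * θ⁻¹ * (k ^ 2 / K ^ 9) := by
      rw [hκ₂]; field_simp; ring
    have e3 : 768 / 3375 * θ⁻¹ * (k ^ 2 / K ^ 9) ≤ 0.183 * (k ^ 2 / K ^ 9) :=
      mul_le_mul_of_nonneg_right (by nlinarith only [hθi]) (by positivity)
    have e4 : 0.183 * ((k : ℝ) ^ 2 / K ^ 9) = 0.183 * k ^ 2 / K ^ 9 := by ring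
    linarith only [e1, e2.le, e3, e4.le]
  -- (B2) the pair term of the climb: `2Kd(r)²(t₁ - r) ≤ 1.66 d(r)²(log k + 19 log K)/K⁹`
  have hc1pos : 0 < X t₁ 2 := hpos t₁ ⟨hrt₁.le, ht₁T⟩
  have hcrpos : 0 < X r 2 := hpos r ⟨le_rfl, hrT⟩
  have hlog : log (X t₁ 2) - log (X r 2) ≤ log k + 19 * log K := by
    have hc1le : X t₁ 2 ≤ ε := by
      have h := (abs_le_of_sq_le_sq' (by nlinarith only [hc1] : X t₁ 2 ^ 2 ≤ (θ * ε / 4) ^ 2)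
        (by positivity)).2
      nlinarith only [h, hθ2, hε]
    have hratio : X t₁ 2 / X r 2 ≤ k * K ^ 19 := by
      rw [div_le_iff₀ hcrpos, hcr]
      have e : (k : ℝ) * K ^ 19 * (ρ ^ 2 / K ^ 9) = ε := by rw [hk]; field_simp
      rw [e]; exact hc1le
    rw [← log_div hc1pos.ne' hcrpos.ne']
    calc log (X t₁ 2 / X r 2) ≤ log (k * K ^ 19) := log_le_log (by positivity) hratio
      _ = log k + 19 * log K := by
          rw [log_mul hk0.ne' (by positivity), log_pow]; push_cast; ring
  have hB2 : 2 * K * X r 3 ^ 2 * (t₁ - r) ≤ 1.66 * X r 3 ^ 2 * (log k + 19 * log K) / K ^ 9 := by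
    have e1 : t₁ - r ≤ 32 * (log k + 19 * log K) / (31 * θ * K ^ 10) :=
      hclimb.trans (div_le_div_of_nonneg_right (by linarith only [hlog]) (by positivity))
    have e2 := mul_le_mul_of_nonneg_left e1 (by positivity : (0 : ℝ) ≤ 2 * K * X r 3 ^ 2)
    have e3 : 2 * K * X r 3 ^ 2 * (32 * (log k + 19 * log K) / (31 * θ * K ^ 10))
        = 64 / 31 * θ⁻¹ * (X r 3 ^ 2 * (log k + 19 * log K) / K ^ 9) := by
      field_simp; ring
    have e4 : 64 / 31 * θ⁻¹ * (X r 3 ^ 2 * (log k + 19 * log K) / K ^ 9)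
        ≤ 1.66 * (X r 3 ^ 2 * (log k + 19 * log K) / K ^ 9) :=
      mul_le_mul_of_nonneg_right (by nlinarith only [hθi]) (by positivity)
    have e5 : 1.66 * (X r 3 ^ 2 * (log k + 19 * log K) / K ^ 9)
        = 1.66 * X r 3 ^ 2 * (log k + 19 * log K) / K ^ 9 := by ring
    linarith only [e2, e3.le, e4, e5.le]
  -- (B3/B9) the drift `6KL(T' - r)² ≤ 0.0015/K⁹`, (B4) the swing `≤ 3.33/K⁹`
  have hL98 : L ≤ 9 / 8 * K := by
    have ha := (abs_le.1 (RotorKnob.traj_abs_le_one hX h0 T' 4)).2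
    rw [hL, ← hσ]
    nlinarith only [ha, hε1, hσρ, hρε, hK, hK0]
  have hL0 : 0 ≤ L := by
    rw [hL]; have := RotorKnob.e_nonneg hX h0 hK0.le (hr.trans hrT); positivity
  have hdrift : 6 * K * L * (T' - r) * (T' - r) ≤ 0.0015 / K ^ 9 := by
    have e1 : 6 * K * L * (T' - r) * (T' - r)
        ≤ 6 * K * (9 / 8 * K) * (242 / K ^ 9) * (242 / K ^ 9) := by
      have := mul_le_mul hτ hτ hτ0 (by positivity)
      have := mul_le_mul hL98 this (by positivity) (by positivity)
      nlinarith only [this, hK0]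
    refine e1.trans ?_
    rw [show 6 * K * (9 / 8 * K) * (242 / K ^ 9) * (242 / K ^ 9)
        = 395307 * K ^ 2 / (K ^ 9 * K ^ 9) by field_simp; ring,
      div_le_div_iff₀ (by positivity) (by positivity)]
    have h7 : (16 : ℝ) ^ 7 ≤ K ^ 7 := pow_le_pow_left₀ (by norm_num) hK 7
    nlinarith only [h7, pow_pos hK0 11]
  have hB3 : 6 * K * L * (T' - r) * (t₁ - r) ≤ 0.0015 / K ^ 9 :=
    (mul_le_mul_of_nonneg_left (by linarith only [ht₁T]) (by positivity)).trans hdrift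
  have hB4 : K * (t₂ - t₁) ≤ 3.33 / K ^ 9 := by
    have e1 := mul_le_mul_of_nonneg_left hswing hK0.le
    have e2 : K * (4.16 / (θ * K ^ 10)) = 4.16 * θ⁻¹ / K ^ 9 := by field_simp
    have e3 : 4.16 * θ⁻¹ / K ^ 9 ≤ 3.33 / K ^ 9 :=
      div_le_div_of_nonneg_right (by nlinarith only [hθi]) (by positivity)
    linarith only [e1, e2.le, e3]
  -- (B6) pair and pin terms of the fall, (B7) `6Kξ²τ`, (B8) `12κ₂σετ` tiny
  have hB6 : K * (2 * X r 3 ^ 2 + 6 * δ ^ 2) * (T' - r)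
      ≤ (482 * X r 3 ^ 2 + 1446 * δ ^ 2) * log K / K ^ 9 := by
    have e1 := mul_le_mul_of_nonneg_left hτ'
      (by positivity : (0 : ℝ) ≤ K * (2 * X r 3 ^ 2 + 6 * δ ^ 2))
    have e2 : K * (2 * X r 3 ^ 2 + 6 * δ ^ 2) * (241 * log K / K ^ 10)
        = (482 * X r 3 ^ 2 + 1446 * δ ^ 2) * log K / K ^ 9 := by field_simp; ring
    linarith only [e1, e2.le]
  have hξ1 : ξ ≤ 1 / K ^ 10 := by
    rw [hξ, div_le_div_iff₀ (by positivity) (by positivity), one_mul]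
    have e1 : k * σ * (T' - r) ≤ k * ρ ^ 2 * (T' - r) :=
      mul_le_mul_of_nonneg_right (mul_le_mul_of_nonneg_left hσρ hk0.le) hτ0
    have e2 : (k : ℝ) * ρ ^ 2 = ε / K ^ 10 := by rw [hρk]; field_simp
    have e3 : T' - r ≤ 1 := by
      refine hτ.trans ?_
      rw [div_le_one (by positivity)]
      nlinarith only [pow_le_pow_left₀ (by norm_num : (0 : ℝ) ≤ 16) hK 9]
    have e4 : ε / K ^ 10 * (T' - r) * K ^ 10 ≤ 15 / 16 * θ * ε := by
      rw [div_mul_eq_mul_div, div_mul_cancel₀ _ (by positivity)]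
      nlinarith only [e3, hθ1, hε, hτ0]
    calc k * σ * (T' - r) * K ^ 10 ≤ k * ρ ^ 2 * (T' - r) * K ^ 10 :=
          mul_le_mul_of_nonneg_right e1 (by positivity)
      _ = ε / K ^ 10 * (T' - r) * K ^ 10 := by rw [e2]
      _ ≤ 15 / 16 * θ * ε := e4
  have hξ0 : 0 ≤ ξ := by rw [hξ]; positivity
  have hB7 : 6 * K * ξ ^ 2 * (T' - r) ≤ 0.001 / K ^ 9 := by
    have e1 : ξ ^ 2 ≤ (1 / K ^ 10) ^ 2 := pow_le_pow_left₀ hξ0 hξ1 2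
    have e2 : 6 * K * ξ ^ 2 * (T' - r) ≤ 6 * K * (1 / K ^ 10) ^ 2 * (242 / K ^ 9) := by
      have := mul_le_mul e1 hτ hτ0 (by positivity)
      nlinarith only [this, hK0]
    refine e2.trans ?_
    rw [show 6 * K * (1 / K ^ 10) ^ 2 * (242 / K ^ 9) = 1452 * K / (K ^ 20 * K ^ 9) by
        field_simp; ring, div_le_div_iff₀ (by positivity) (by positivity)]
    have h19 : (16 : ℝ) ^ 19 ≤ K ^ 19 := pow_le_pow_left₀ (by norm_num) hK 19
    nlinarith only [h19, pow_pos hK0 10]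
  have hB8 : 12 * κ₂ * σ * ε * (T' - r) ≤ 0.001 / K ^ 9 := by
    have e1 : κ₂ * ρ ^ 2 * ε = 4096 / 3375 * (θ ^ 3)⁻¹ * (K * k / K ^ 20) := by
      rw [hκ₂, hρk]; field_simp; ring
    have hθ3 : (θ ^ 3)⁻¹ ≤ 1 := inv_le_one_of_one_le₀ (one_le_pow₀ (by linarith only [hθ1]))
    have e2 : K * k / K ^ 20 ≤ 1 / (200 * K ^ 9) := by
      rw [div_le_div_iff₀ (by positivity) (by positivity)]
      nlinarith only [h200, pow_pos hK0 10, hK0]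
    have e3 : κ₂ * ρ ^ 2 * ε ≤ 4096 / 3375 * 1 * (1 / (200 * K ^ 9)) := by
      rw [e1]; exact mul_le_mul (mul_le_mul_of_nonneg_left hθ3 (by norm_num)) e2
        (by positivity) (by positivity)
    have e4 : 12 * κ₂ * σ * ε * (T' - r) ≤ 12 * (κ₂ * ρ ^ 2 * ε) * (242 / K ^ 9) := by
      have := mul_le_mul (mul_le_mul_of_nonneg_left hσρ hκ₂0) hτ hτ0 (by positivity)
      nlinarith only [this, hε.le]
    refine e4.trans ?_
    have e5 : 12 * (κ₂ * ρ ^ 2 * ε) * (242 / K ^ 9)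
        ≤ 12 * (4096 / 3375 * 1 * (1 / (200 * K ^ 9))) * (242 / K ^ 9) :=
      mul_le_mul_of_nonneg_right (mul_le_mul_of_nonneg_left e3 (by norm_num)) (by positivity)
    refine e5.trans ?_
    rw [show 12 * (4096 / 3375 * 1 * (1 / (200 * (K : ℝ) ^ 9))) * (242 / K ^ 9)
        = 12 * 4096 * 242 / (3375 * 200) / (K ^ 9 * K ^ 9) by field_simp,
      div_le_div_iff₀ (by positivity) (by positivity)]
    have h9 : (16 : ℝ) ^ 9 ≤ K ^ 9 := pow_le_pow_left₀ (by norm_num) hK 9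
    nlinarith only [h9, pow_pos hK0 9]
  -- the fall bracket at `T' - t₂ ≤ T' - r`
  have hfall : (K * (2 * X r 3 ^ 2 + 6 * δ ^ 2 + 6 * ξ ^ 2) + 12 * κ₂ * σ * ε
        + 6 * K * L * (T' - r)) * (T' - t₂)
      ≤ (482 * X r 3 ^ 2 + 1446 * δ ^ 2) * log K / K ^ 9 + 0.001 / K ^ 9 + 0.001 / K ^ 9
        + 0.0015 / K ^ 9 := by
    have e1 : (K * (2 * X r 3 ^ 2 + 6 * δ ^ 2 + 6 * ξ ^ 2) + 12 * κ₂ * σ * ε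
          + 6 * K * L * (T' - r)) * (T' - t₂)
        ≤ (K * (2 * X r 3 ^ 2 + 6 * δ ^ 2 + 6 * ξ ^ 2) + 12 * κ₂ * σ * ε
          + 6 * K * L * (T' - r)) * (T' - r) :=
      mul_le_mul_of_nonneg_left (by linarith only [hrt₂]) (by positivity)
    have e2 : (K * (2 * X r 3 ^ 2 + 6 * δ ^ 2 + 6 * ξ ^ 2) + 12 * κ₂ * σ * ε
          + 6 * K * L * (T' - r)) * (T' - r)
        = K * (2 * X r 3 ^ 2 + 6 * δ ^ 2) * (T' - r) + 6 * K * ξ ^ 2 * (T' - r)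
          + 12 * κ₂ * σ * ε * (T' - r) + 6 * K * L * (T' - r) * (T' - r) := by ring
    linarith only [e1, e2.le, hB6, hB7, hB8, hdrift]
  -- the sum
  have hK9 : (0 : ℝ) < K ^ 9 := by positivity
  have hsum : X T' 4 - X r 4 ≤ (0.056 * k ^ 2 + 1.66 * X r 3 ^ 2 * (log k + 19 * log K)
      + 0.0015 + 3.33 + 0.183 * k ^ 2 + (482 * X r 3 ^ 2 + 1446 * δ ^ 2) * log K
      + 0.001 + 0.001 + 0.0015) / K ^ 9 := by
    have e : (0.056 * k ^ 2 + 1.66 * X r 3 ^ 2 * (log k + 19 * log K)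
        + 0.0015 + 3.33 + 0.183 * k ^ 2 + (482 * X r 3 ^ 2 + 1446 * δ ^ 2) * log K
        + 0.001 + 0.001 + 0.0015) / K ^ 9
        = 0.056 * k ^ 2 / K ^ 9 + 1.66 * X r 3 ^ 2 * (log k + 19 * log K) / K ^ 9
          + 0.0015 / K ^ 9 + 3.33 / K ^ 9 + 0.183 * k ^ 2 / K ^ 9
          + ((482 * X r 3 ^ 2 + 1446 * δ ^ 2) * log K / K ^ 9 + 0.001 / K ^ 9
            + 0.001 / K ^ 9 + 0.0015 / K ^ 9) := by
      field_simp
      ring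
    rw [e]
    linarith only [hΔ1, hΔ2, hΔ3, hB1, hB2, hB3, hB4, hB5, hfall]
  refine hsum.trans (div_le_div_of_nonneg_right ?_ hK9.le)
  nlinarith only [hlogK, hlogk, hd0, sq_nonneg δ, mul_nonneg hd0 hlogK, mul_nonneg hd0 hlogk,
    mul_nonneg (sq_nonneg δ) hlogK, sq_nonneg (k : ℝ)]

end Summit.NavierStokesRegularity.FluidComputer.GateBudget
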